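import Literature.Geometry.Kaehler.WedgeShuffleProofs
import HarnessLib

/-!
# The wedge of pull-backs along the two projections, on block vectors

Topic: Kähler / Hodge, pointwise exterior algebra. For the wedge product of
`Literature/NumberTheory/Transcendental/FormsAlgebra.lean` (`ContinuousAlternatingMap.wedge`, Warner's
normalisation) and a product `V = E × E'`, the **cross product** `pr₁^*α ∧ pr₂^*β` of a `k`-form `α`
on `E` and an `l`-form `β` on `E'` evaluated on a **block family** — `p` horizontal vectors
`(uᵢ, 0)` followed by `q` vertical vectors `(0, u'ⱼ)`, `p + q = k + l` — is

* `α(u) β(u')` if `p = k` (`wedge_fst_snd_apply_blockVec`), and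
* `0` if `p ≠ k` (`wedge_fst_snd_apply_blockVec_eq_zero`).

Proof from the shuffle form `wedge_apply_eq_sum_powersetCard` (sum over `k`-subsets `s`): the
`s`-term vanishes unless the increasing enumeration of `s` stays in the horizontal block and that
of `sᶜ` in the vertical block, which forces `p = k` and `s = {0, …, k-1}`, whose shuffle is the
identity. This is the pointwise input "`(α ⊠ β)` of block vectors is the product" of the
comparison of the de Rham (wedge) product with the cup product through the Eilenberg–Zilber
shuffle map (`Literature/Geometry/Manifold/ShuffleFubini`).

## References

* F. W. Warner, *Foundations of Differentiable Manifolds and Lie Groups*, GTM 94 (1983), 2.10(b). [Warner1983]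
-/

noncomputable section

open Module ContinuousAlternatingMap Function Set.powersetCard
open Literature.Geometry.Kaehler.HodgeStarAux

namespace Literature.Geometry.Kaehler

section Block

variable {𝕜 : Type*} [RCLike 𝕜] {E E' : Type*} [NormedAddCommGroup E] [NormedSpace 𝕜 E]
  [NormedAddCommGroup E'] [NormedSpace 𝕜 E'] {A : Type*} [NormedCommRing A] [NormedAlgebra 𝕜 A]
  {k l p q n : ℕ}

/-- **Block families** of `E × E'`: `p` horizontal vectors `(uᵢ, 0)` followed by `q` vertical
vectors `(0, u'ⱼ)`, indexed by `Fin n`, `p + q = n`. [folklore] -/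
def blockVec (p q n : ℕ) (h : p + q = n) (u : Fin p → E) (u' : Fin q → E') (i : Fin n) : E × E' :=
  if hi : (i : ℕ) < p then (u ⟨i, hi⟩, 0) else (0, u' ⟨i - p, by omega⟩)

/-- Horizontal entries of a block family. [folklore] -/
theorem blockVec_of_lt (h : p + q = n) (u : Fin p → E) (u' : Fin q → E') {i : Fin n} (hi : (i : ℕ) < p) :
    blockVec p q n h u u' i = (u ⟨i, hi⟩, 0) := dif_pos hi

/-- Vertical entries of a block family. [folklore] -/
theorem blockVec_of_le (h : p + q = n) (u : Fin p → E) (u' : Fin q → E') {i : Fin n} (hi : p ≤ (i : ℕ)) :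
    blockVec p q n h u u' i = (0, u' ⟨i - p, by omega⟩) := dif_neg (Nat.not_lt.mpr hi)

/-- The `s`-term of the shuffle formula for `pr₁^*α ∧ pr₂^*β` on a block family vanishes unless the
enumeration of `s` is horizontal and that of `sᶜ` vertical. [folklore] -/
theorem wedge_fst_snd_term_eq_zero_or (h : p + q = k + l) (α : E [⋀^Fin k]→L[𝕜] A) (β : E' [⋀^Fin l]→L[𝕜] A)
    (u : Fin p → E) (u' : Fin q → E') (s : Set.powersetCard (Fin (k + l)) k) :
    (α.compContinuousLinearMap (ContinuousLinearMap.fst 𝕜 E E') (blockVec p q (k + l) h u u' ∘ ofFinEmbEquiv.symm s) *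
        β.compContinuousLinearMap (ContinuousLinearMap.snd 𝕜 E E')
          (blockVec p q (k + l) h u u' ∘ ofFinEmbEquiv.symm (Set.powersetCard.compl card_fin_add s)) = 0) ∨
      ((∀ i, ((ofFinEmbEquiv.symm s i : Fin (k + l)) : ℕ) < p) ∧
        ∀ j, p ≤ ((ofFinEmbEquiv.symm (Set.powersetCard.compl card_fin_add s) j : Fin (k + l)) : ℕ)) := by
  by_cases h1 : ∀ i, ((ofFinEmbEquiv.symm s i : Fin (k + l)) : ℕ) < p
  · by_cases h2 : ∀ j, p ≤ ((ofFinEmbEquiv.symm (Set.powersetCard.compl card_fin_add s) j : Fin (k + l)) : ℕ)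
    · exact Or.inr ⟨h1, h2⟩
    · left
      obtain ⟨j, hj⟩ := not_forall.mp h2
      rw [not_le] at hj
      have : β.compContinuousLinearMap (ContinuousLinearMap.snd 𝕜 E E')
          (blockVec p q (k + l) h u u' ∘ ofFinEmbEquiv.symm (Set.powersetCard.compl card_fin_add s)) = 0 := by
        rw [compContinuousLinearMap_apply]
        exact map_coord_zero _ j (by simp [blockVec_of_lt h u u' hj])
      rw [this, mul_zero]
  · left
    obtain ⟨i, hi⟩ := not_forall.mp h1
    rw [not_lt] at hi
    have : α.compContinuousLinearMap (ContinuousLinearMap.fst 𝕜 E E') (blockVec p q (k + l) h u u' ∘ ofFinEmbEquiv.symm s) = 0 := by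
      rw [compContinuousLinearMap_apply]
      exact map_coord_zero _ i (by simp [blockVec_of_le h u u' hi])
    rw [this, zero_mul]

/-- If the enumeration of a `k`-subset of `Fin (k+l)` is `< p` and that of its complement `≥ p`
(`p + q = k + l`), then `p = k`. [folklore] -/
theorem eq_of_enum_lt_of_compl_ge (h : p + q = k + l) (s : Set.powersetCard (Fin (k + l)) k)
    (h1 : ∀ i, ((ofFinEmbEquiv.symm s i : Fin (k + l)) : ℕ) < p)
    (h2 : ∀ j, p ≤ ((ofFinEmbEquiv.symm (Set.powersetCard.compl card_fin_add s) j : Fin (k + l)) : ℕ)) : p = k := by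
  -- `s ⊆ {x < p}` gives `k ≤ p`; `sᶜ ⊆ {x ≥ p}` gives `l ≤ q`
  have hk : k ≤ p := by
    have hinj : Function.Injective fun i : Fin k ↦ (⟨((ofFinEmbEquiv.symm s i : Fin (k + l)) : ℕ), h1 i⟩ : Fin p) :=
      fun i j hij ↦ (ofFinEmbEquiv.symm s).injective (Fin.ext (by simpa only [Fin.mk.injEq] using hij))
    simpa using Fintype.card_le_of_injective _ hinj
  have hl : l ≤ q := by
    have hinj : Function.Injective fun j : Fin l ↦
        (⟨((ofFinEmbEquiv.symm (Set.powersetCard.compl card_fin_add s) j : Fin (k + l)) : ℕ) - p, by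
          have := (ofFinEmbEquiv.symm (Set.powersetCard.compl card_fin_add s) j).2; have := h2 j; omega⟩ : Fin q) := by
      intro i j hij
      simp only [Fin.mk.injEq] at hij
      have hi := h2 i; have hj := h2 j
      exact (ofFinEmbEquiv.symm (Set.powersetCard.compl card_fin_add s)).injective (Fin.ext (by omega))
    simpa using Fintype.card_le_of_injective _ hinj
  omega

/-- **Mismatched blocks**: `(pr₁^*α ∧ pr₂^*β)` vanishes on a block family with `p ≠ k` horizontal
vectors. [cite: Warner1983, 2.10(b)] -/
theorem wedge_fst_snd_apply_blockVec_eq_zero (h : p + q = k + l) (hp : p ≠ k) (α : E [⋀^Fin k]→L[𝕜] A)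
    (β : E' [⋀^Fin l]→L[𝕜] A) (u : Fin p → E) (u' : Fin q → E') :
    (α.compContinuousLinearMap (ContinuousLinearMap.fst 𝕜 E E')).wedge
        (β.compContinuousLinearMap (ContinuousLinearMap.snd 𝕜 E E')) (blockVec p q (k + l) h u u') = 0 := by
  rw [wedge_apply_eq_sum_powersetCard]
  refine Finset.sum_eq_zero fun s _ ↦ ?_
  rcases wedge_fst_snd_term_eq_zero_or h α β u u' s with h0 | ⟨h1, h2⟩
  · rw [h0, smul_zero]
  · exact absurd (eq_of_enum_lt_of_compl_ge h s h1 h2) hp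

/-- The initial segment `{0, …, k-1}` of `Fin (k + l)` as a `k`-subset. [folklore] -/
def initialBlock (k l : ℕ) : Set.powersetCard (Fin (k + l)) k :=
  ⟨Finset.univ.map (Fin.castAddEmb l), by rw [Set.powersetCard.mem_iff, Finset.card_map, Finset.card_univ, Fintype.card_fin]⟩

/-- Membership in the initial segment. [folklore] -/
theorem mem_initialBlock_iff {x : Fin (k + l)} : x ∈ initialBlock k l ↔ (x : ℕ) < k := by
  change x ∈ (Finset.univ.map (Fin.castAddEmb l)) ↔ _
  simp only [Finset.mem_map, Finset.mem_univ, true_and, Fin.castAddEmb_apply]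
  constructor
  · rintro ⟨i, rfl⟩; simp
  · intro hx; exact ⟨⟨x, hx⟩, Fin.ext rfl⟩

/-- The increasing enumeration of the initial segment is `castAdd`. [folklore] -/
theorem enum_initialBlock : ⇑(ofFinEmbEquiv.symm (initialBlock k l)) = Fin.castAdd l := by
  rw [ofFinEmbEquiv_symm_apply]
  refine (Finset.orderEmbOfFin_unique (initialBlock k l).prop (f := Fin.castAdd l) (fun i ↦ ?_) (fun i j hij ↦ ?_)).symm
  · exact Finset.mem_map_of_mem _ (Finset.mem_univ i)
  · exact hij

/-- The increasing enumeration of the complement of the initial segment is `natAdd`. [folklore] -/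
theorem enum_compl_initialBlock :
    ⇑(ofFinEmbEquiv.symm (Set.powersetCard.compl card_fin_add (initialBlock k l))) = Fin.natAdd k := by
  rw [ofFinEmbEquiv_symm_apply]
  refine (Finset.orderEmbOfFin_unique _ (f := Fin.natAdd k) (fun j ↦ ?_) (fun i j hij ↦ ?_)).symm
  · have hmem : Fin.natAdd k j ∈ Set.powersetCard.compl card_fin_add (initialBlock k l) := by
      rw [Set.powersetCard.mem_compl, mem_initialBlock_iff]
      simp
    exact hmem
  · simpa using hij

/-- The shuffle of the initial segment is the identity. [folklore] -/
theorem blockPerm_initialBlock_eq_one :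
    Equiv.ofBijective _ (blockMap_bijective (initialBlock k l) 1 1) = 1 := by
  refine Equiv.ext fun x ↦ ?_
  induction x using Fin.addCases with
  | left i => rw [blockPerm_apply_castAdd, Equiv.Perm.one_apply, Equiv.Perm.one_apply, enum_initialBlock]
  | right j => rw [blockPerm_apply_natAdd, Equiv.Perm.one_apply, Equiv.Perm.one_apply, enum_compl_initialBlock]

/-- **Matched blocks**: `(pr₁^*α ∧ pr₂^*β)((u₀,0),…,(u_{k-1},0),(0,u'₀),…,(0,u'_{l-1})) = α(u) β(u')`.
[cite: Warner1983, 2.10(b)] -/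
theorem wedge_fst_snd_apply_blockVec (α : E [⋀^Fin k]→L[𝕜] A) (β : E' [⋀^Fin l]→L[𝕜] A) (u : Fin k → E) (u' : Fin l → E') :
    (α.compContinuousLinearMap (ContinuousLinearMap.fst 𝕜 E E')).wedge
        (β.compContinuousLinearMap (ContinuousLinearMap.snd 𝕜 E E')) (blockVec k l (k + l) rfl u u') = α u * β u' := by
  rw [wedge_apply_eq_sum_powersetCard, Finset.sum_eq_single (initialBlock k l)]
  · rw [blockPerm_initialBlock_eq_one, Equiv.Perm.sign_one, one_smul, enum_initialBlock, enum_compl_initialBlock,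
      compContinuousLinearMap_apply, compContinuousLinearMap_apply]
    congr 1
    · congr 1
      funext i
      simp [blockVec_of_lt rfl u u' (show ((Fin.castAdd l i : Fin (k + l)) : ℕ) < k from i.2)]
    · congr 1
      funext j
      simp [blockVec_of_le rfl u u' (show k ≤ ((Fin.natAdd k j : Fin (k + l)) : ℕ) by simp)]
  · intro s _ hs
    rcases wedge_fst_snd_term_eq_zero_or rfl α β u u' s with h0 | ⟨h1, -⟩
    · rw [h0, smul_zero]
    · exfalso
      apply hs
      -- `s ⊆ initialBlock`, both of cardinality `k`
      refine SetLike.ext' ?_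
      change ((s : Finset (Fin (k + l))) : Set (Fin (k + l))) = ((initialBlock k l : Set.powersetCard _ _) : Finset (Fin (k + l)))
      rw [Finset.coe_inj]
      refine Finset.eq_of_subset_of_card_le (fun x hx ↦ ?_) ?_
      · obtain ⟨i, rfl⟩ := exists_enum_eq_of_mem (s := s) hx
        exact (mem_initialBlock_iff (k := k) (l := l)).2 (h1 i)
      · rw [Set.powersetCard.mem_iff.mp s.2, Set.powersetCard.mem_iff.mp (initialBlock k l).2]
  · intro h; exact absurd (Finset.mem_univ _) h

end Block

end Literature.Geometry.Kaehler
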